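import Literature.MathematicalPhysics.QuantumFieldTheory.Balaban1983to89.Beta.WilsonBiStencil

/-!
# `BalabanUV.Beta.GAN24.WilsonQuarticCharge` — binder row G-an2-4 / (CONV-C), W-slot, road «W3», ROW W3-F4d input:
# THE FOUR-CONSTANT-LEG CHARGE (field–field zero mode) OF an3's WILSON BI-STENCIL `wilsonW₂ d T`, AS AN EXPLICIT FINITE
# FUNCTIONAL OF THE POSITION TABLE `T`, AND ITS NON-VANISHING AT THE COLOUR-TRACED TABLE `w22 N`

NOT IN PRINT; OUR BOOKKEEPING (G-an2-4 formalisation swarm, leaf seat `b2b-balaban-gan24-formalise-leaf-18`, gen 16; module name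
PROVISIONAL — the row owner gan24-p1 may rename or re-home it).  HONEST FRAMING (cell contract, verbatim): «discharging `BetaPertH` makes
Bałaban's UV stability UNCONDITIONAL — a real constructive-QFT result; it is NOT the continuum limit and NOT the Clay problem.»  HONEST
DEPENDENCY (verbatim): «continuum YM on T⁴ ⇐ BetaPertH ∧ nine spine estimates (0/9 proved); BetaPertH ⇐ (D1) ∧ (D4) ∧ CAP+tail; G-an2-4
gates asym, D1 and NE2/3/4.»  THIS MODULE DISCHARGES NOTHING of the wall: it is [folklore] finite algebra over an3's DEFINED tables
(`WilsonBiStencil.wilsonW₂` / `WilsonVertex2Kron.bondPairTab` / `cellTab` / `plaqTab`, `PlaquetteVertex2Trace.w22`) and three `HasSum`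
book-keeping lemmas on `ℤ^{d+1}`.  0 `def`, 0 `def … : Prop`, 0 cite, 0 sorry.  ABSOLUTE RULE (cell, verbatim): «No internally-minted
statement may enter as a cited fact. Every hypothesis is either kernel-proved in this package or a verbatim quotation of a PUBLISHED theorem
with page reference. The manuscript(s) under audit are NOT citable for their own disputed steps — they are the thing under adjudication;
programme-internal (2001/route/tribunal) claims are never citable.»

WHY (row owner's SKELETON-W3 v1.0 §8.3 / RULINGS-14d, journal l.7891 / l.8097).  END #2 of road «W3» (`WSlotT2OfPieces.t2Drift_of_rows`)
takes the zero mode of the FIRST DIFFERENCE of the normalised bi-stencil tower, `hZ0 : Zfree (T♮₁ − T♮₀)`.  By the affine step and the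
zero-mode calculus, `Z_ff(T♮₁ − T♮₀) = (λ − 1)·Z_ff(T♮₀)` with `Z_ff(T♮₀) = cE₂ · (the four-constant-leg charge of wilsonW₂ d Tc)`
(`T2SlotUnits.unitS₂_T2Of_zero`: member `0` is `cE₂ • wilsonW₂ d Tc` plus an OFF-DIAGONAL border).  RULINGS-14d therefore makes ROW W3-F4d
carry the EXACT pin `λ = 1` — PROVIDED the quartic charge is nonzero.  THIS FILE computes that charge: for every position table `T` it is
the explicit plaquette-frame functional of §2, and at the colour-traced table `w22 N` it equals `−2N²` on the index pattern
`(κ, κ; α, α)`, `κ ≠ α` (the `tr [A_κ, A_α]²` structure of the non-abelian quartic vertex on constants) — NONZERO for `N ≠ 0`, `1 ≤ d`.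
Hence the second pin tier is NECESSARY for ROW W3-F4d, not only sufficient (R14-5: no row hides the pin).  Contrast (S3c): the CUBIC
table dies on two constant legs (`WilsonVertexTwoLegSums`, `WilsonVertexTwoConst`); the QUARTIC does not die on four.

CONTENT (generic `d`; all [folklore]).
* §1 `HasSum` bookkeeping on any index type: `hasSum_ite_prop`, `hasSum_ite_and_eq`, `hasSum_ite_and_and_eq'`.
* §2 **`hasSum_wilsonW₂_ff_z` / `_x` / `_u'`** — the three successive point-mass sums — and **`tsum_wilsonW₂_ff_eq`**:
  `∑' u′, ∑' x, ∑' z, wilsonW₂ d T κ u κ′ u′ x z (inl α) (inl β)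
     = ∑ μ ν, ∑ k l, [dir μ ν k = κ ∧ dir μ ν l = κ′] · ∑ i j, [α = dir μ ν i ∧ β = dir μ ν j] · T i j k l`
  (every first bond `(κ, u)`; `k, l` = the table's background positions, `i, j` = row/column; the `μ = ν` cells are present, as in
  `bondPairTab`).
* §3 THE VALUE AT `w22 N` on the pattern `(κ, κ; α, α)`, `κ ≠ α`: `dir_eq_or`, the two frame sums `frame_w22_bg02_fl13`,
  `frame_w22_bg13_fl02` (explicit rationals `× N²`), **`tsum_wilsonW₂_w22_ff_diag_offdiag`** `= −2·N²`, and
  **`tsum_wilsonW₂_w22_ff_ne_zero`** (`N ≠ 0`, `κ ≠ α`).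
-/

noncomputable section

namespace Summit.QuantumFields.BalabanUV.Beta.GAN24.WilsonQuarticCharge

open Finset
open scoped BigOperators
open Literature.MathematicalPhysics.QuantumFieldTheory
open Literature.MathematicalPhysics.QuantumFieldTheory.Balaban1983to89
open Literature.MathematicalPhysics.QuantumFieldTheory.Balaban1983to89.Beta
open B6BondElimination (unitVec)
open PlaquetteVertex2Stencil (dir off)
open PlaquetteVertex2Coords (sgn)
open PlaquetteVertex2Polar (inc qq)
open PlaquetteVertex2Trace (w22 wSym wPair)
open WilsonVertex2Kron (bondPairTab cellTab plaqTab plaqTab_apply ite_apply₂)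
open WilsonBiStencil (wilsonW₂ wEntry₂ wilsonW₂_inl_inl)

variable {d : ℕ}

/-! ## §1 `HasSum` bookkeeping: guarded point masses -/

section HasSum

variable {ι : Type*}

/-- [folklore] A `HasSum` guarded by a constant proposition. -/
theorem hasSum_ite_prop (P : Prop) [Decidable P] {f : ι → ℝ} {a : ℝ} (h : HasSum f a) :
    HasSum (fun b => if P then f b else 0) (if P then a else 0) := by
  by_cases hP : P
  · simp only [hP, if_true]; exact h
  · simp only [hP, if_false]; exact hasSum_zero

/-- [folklore] A point mass guarded by a constant proposition: `Σ_z [P ∧ z = q]·c = [P]·c`. -/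
theorem hasSum_ite_and_eq [DecidableEq ι] (P : Prop) [Decidable P] (q : ι) (c : ℝ) :
    HasSum (fun z => if P ∧ z = q then c else 0) (if P then c else 0) := by
  by_cases hP : P
  · simp only [hP, true_and, if_true]; exact hasSum_ite_eq q c
  · simp only [hP, false_and, if_false]; exact hasSum_zero

/-- [folklore] A point mass written `q = z`, guarded by two constant propositions: `Σ_z [P ∧ Q ∧ q = z]·c = [P ∧ Q]·c`. -/
theorem hasSum_ite_and_and_eq' [DecidableEq ι] (P Q : Prop) [Decidable P] [Decidable Q] (q : ι) (c : ℝ) :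
    HasSum (fun z => if P ∧ Q ∧ q = z then c else 0) (if P ∧ Q then c else 0) := by
  by_cases hP : P ∧ Q
  · have hfun : (fun z => if P ∧ Q ∧ q = z then c else 0) = fun z => if z = q then c else 0 := by
      funext z
      simp only [hP.1, hP.2, true_and, @eq_comm _ q z]
    rw [hfun, if_pos hP]
    exact hasSum_ite_eq q c
  · have hPQ : ∀ z, ¬(P ∧ Q ∧ q = z) := fun z h => hP ⟨h.1, h.2.1⟩
    simp only [hPQ, if_false, hP]
    exact hasSum_zero

end HasSum

/-! ## §2 The four-constant-leg charge of `wilsonW₂ d T` as a finite functional of `T` -/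

section Charge

variable (T : Fin 4 → Fin 4 → Fin 4 → Fin 4 → ℝ)

/-- [folklore] THE ENTRY FORMULA of the field block of an3's bi-stencil, unfolded down to the plaquette cells:
`wilsonW₂ d T κ u κ′ u′ x z (inl α) (inl β) = Σ_{μ ν k l} [dir k = κ ∧ dir l = κ′ ∧ u − off k + off l = u′] ·
Σ_{i j} [x = (u − off k) + off i ∧ z = (u − off k) + off j] · [α = dir i ∧ β = dir j] · T i j k l`. -/
theorem wilsonW₂_ff_apply (κ : Fin (d + 1)) (u : Fin (d + 1) → ℤ) (κ' : Fin (d + 1)) (u' x z : Fin (d + 1) → ℤ)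
    (α β : Fin (d + 1)) :
    wilsonW₂ d T κ u κ' u' x z (Sum.inl α) (Sum.inl β) =
      ∑ μ : Fin (d + 1), ∑ ν : Fin (d + 1), ∑ k : Fin 4, ∑ l : Fin 4,
        if dir μ ν k = κ ∧ dir μ ν l = κ' ∧ u - off unitVec μ ν k + off unitVec μ ν l = u' then
          ∑ i : Fin 4, ∑ j : Fin 4,
            if x = u - off unitVec μ ν k + off unitVec μ ν i ∧ z = u - off unitVec μ ν k + off unitVec μ ν j then
              (if α = dir μ ν i ∧ β = dir μ ν j then T i j k l else 0) else 0
        else 0 := by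
  rw [wilsonW₂_inl_inl]
  simp only [wEntry₂, bondPairTab, Matrix.sum_apply, cellTab, ite_apply₂, plaqTab_apply]

/-- [folklore] **THE COLUMN-LEG SUM** (point masses in `z`). -/
theorem hasSum_wilsonW₂_ff_z (κ : Fin (d + 1)) (u : Fin (d + 1) → ℤ) (κ' : Fin (d + 1)) (u' x : Fin (d + 1) → ℤ)
    (α β : Fin (d + 1)) :
    HasSum (fun z => wilsonW₂ d T κ u κ' u' x z (Sum.inl α) (Sum.inl β))
      (∑ μ : Fin (d + 1), ∑ ν : Fin (d + 1), ∑ k : Fin 4, ∑ l : Fin 4,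
        if dir μ ν k = κ ∧ dir μ ν l = κ' ∧ u - off unitVec μ ν k + off unitVec μ ν l = u' then
          ∑ i : Fin 4, ∑ j : Fin 4,
            if x = u - off unitVec μ ν k + off unitVec μ ν i then
              (if α = dir μ ν i ∧ β = dir μ ν j then T i j k l else 0) else 0
        else 0) := by
  have hf : (fun z => wilsonW₂ d T κ u κ' u' x z (Sum.inl α) (Sum.inl β)) = fun z =>
      ∑ μ : Fin (d + 1), ∑ ν : Fin (d + 1), ∑ k : Fin 4, ∑ l : Fin 4,
        if dir μ ν k = κ ∧ dir μ ν l = κ' ∧ u - off unitVec μ ν k + off unitVec μ ν l = u' then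
          ∑ i : Fin 4, ∑ j : Fin 4,
            if x = u - off unitVec μ ν k + off unitVec μ ν i ∧ z = u - off unitVec μ ν k + off unitVec μ ν j then
              (if α = dir μ ν i ∧ β = dir μ ν j then T i j k l else 0) else 0
        else 0 := by
    funext z; exact wilsonW₂_ff_apply T κ u κ' u' x z α β
  rw [hf]
  refine hasSum_sum fun μ _ => hasSum_sum fun ν _ => hasSum_sum fun k _ => hasSum_sum fun l _ => ?_
  refine hasSum_ite_prop _ (hasSum_sum fun i _ => hasSum_sum fun j _ => ?_)
  exact hasSum_ite_and_eq _ _ _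

/-- [folklore] **THE ROW-LEG SUM** (point masses in `x`) of the column-leg sums. -/
theorem hasSum_wilsonW₂_ff_x (κ : Fin (d + 1)) (u : Fin (d + 1) → ℤ) (κ' : Fin (d + 1)) (u' : Fin (d + 1) → ℤ)
    (α β : Fin (d + 1)) :
    HasSum (fun x : Fin (d + 1) → ℤ =>
      ∑ μ : Fin (d + 1), ∑ ν : Fin (d + 1), ∑ k : Fin 4, ∑ l : Fin 4,
        if dir μ ν k = κ ∧ dir μ ν l = κ' ∧ u - off unitVec μ ν k + off unitVec μ ν l = u' then
          ∑ i : Fin 4, ∑ j : Fin 4,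
            if x = u - off unitVec μ ν k + off unitVec μ ν i then
              (if α = dir μ ν i ∧ β = dir μ ν j then T i j k l else 0) else 0
        else 0)
      (∑ μ : Fin (d + 1), ∑ ν : Fin (d + 1), ∑ k : Fin 4, ∑ l : Fin 4,
        if dir μ ν k = κ ∧ dir μ ν l = κ' ∧ u - off unitVec μ ν k + off unitVec μ ν l = u' then
          ∑ i : Fin 4, ∑ j : Fin 4, (if α = dir μ ν i ∧ β = dir μ ν j then T i j k l else 0)
        else 0) := by
  refine hasSum_sum fun μ _ => hasSum_sum fun ν _ => hasSum_sum fun k _ => hasSum_sum fun l _ => ?_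
  refine hasSum_ite_prop _ (hasSum_sum fun i _ => hasSum_sum fun j _ => ?_)
  exact hasSum_ite_eq _ _

/-- [folklore] **THE SECOND-BOND SUM** (point masses in `u′`) of the row- and column-leg sums. -/
theorem hasSum_wilsonW₂_ff_u' (κ : Fin (d + 1)) (u : Fin (d + 1) → ℤ) (κ' : Fin (d + 1)) (α β : Fin (d + 1)) :
    HasSum (fun u' : Fin (d + 1) → ℤ =>
      ∑ μ : Fin (d + 1), ∑ ν : Fin (d + 1), ∑ k : Fin 4, ∑ l : Fin 4,
        if dir μ ν k = κ ∧ dir μ ν l = κ' ∧ u - off unitVec μ ν k + off unitVec μ ν l = u' then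
          ∑ i : Fin 4, ∑ j : Fin 4, (if α = dir μ ν i ∧ β = dir μ ν j then T i j k l else 0)
        else 0)
      (∑ μ : Fin (d + 1), ∑ ν : Fin (d + 1), ∑ k : Fin 4, ∑ l : Fin 4,
        if dir μ ν k = κ ∧ dir μ ν l = κ' then
          ∑ i : Fin 4, ∑ j : Fin 4, (if α = dir μ ν i ∧ β = dir μ ν j then T i j k l else 0)
        else 0) := by
  refine hasSum_sum fun μ _ => hasSum_sum fun ν _ => hasSum_sum fun k _ => hasSum_sum fun l _ => ?_
  exact hasSum_ite_and_and_eq' _ _ _ _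

/-- [folklore] **THE FOUR-CONSTANT-LEG CHARGE OF an3's WILSON BI-STENCIL AS A FINITE FUNCTIONAL OF THE POSITION TABLE** (every first
bond `(κ, u)`, every position table `T`, every `d`):
`∑' u′, ∑' x, ∑' z, wilsonW₂ d T κ u κ′ u′ x z (inl α) (inl β) = Σ_{μ ν} Σ_{k l} [dir k = κ ∧ dir l = κ′] · Σ_{i j} [α = dir i ∧ β = dir j] · T i j k l`
— the field–field zero mode per first bond (table leg `u′` and both kernel legs summed, directions fixed): the number the W3 zero-mode
calculus reads for member `0` of an2's `T2Of` (up to the scalar `cE₂`). -/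
theorem tsum_wilsonW₂_ff_eq (κ : Fin (d + 1)) (u : Fin (d + 1) → ℤ) (κ' : Fin (d + 1)) (α β : Fin (d + 1)) :
    ∑' u' : Fin (d + 1) → ℤ, ∑' x : Fin (d + 1) → ℤ, ∑' z : Fin (d + 1) → ℤ, wilsonW₂ d T κ u κ' u' x z (Sum.inl α) (Sum.inl β) =
      ∑ μ : Fin (d + 1), ∑ ν : Fin (d + 1), ∑ k : Fin 4, ∑ l : Fin 4,
        if dir μ ν k = κ ∧ dir μ ν l = κ' then
          ∑ i : Fin 4, ∑ j : Fin 4, (if α = dir μ ν i ∧ β = dir μ ν j then T i j k l else 0)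
        else 0 := by
  have h1 : ∀ u' x : Fin (d + 1) → ℤ, ∑' z : Fin (d + 1) → ℤ, wilsonW₂ d T κ u κ' u' x z (Sum.inl α) (Sum.inl β) = _ :=
    fun u' x => (hasSum_wilsonW₂_ff_z T κ u κ' u' x α β).tsum_eq
  have h2 : ∀ u' : Fin (d + 1) → ℤ, ∑' x : Fin (d + 1) → ℤ, (∑ μ : Fin (d + 1), ∑ ν : Fin (d + 1), ∑ k : Fin 4, ∑ l : Fin 4,
        if dir μ ν k = κ ∧ dir μ ν l = κ' ∧ u - off unitVec μ ν k + off unitVec μ ν l = u' then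
          ∑ i : Fin 4, ∑ j : Fin 4,
            if x = u - off unitVec μ ν k + off unitVec μ ν i then
              (if α = dir μ ν i ∧ β = dir μ ν j then T i j k l else 0) else 0
        else 0) = _ :=
    fun u' => (hasSum_wilsonW₂_ff_x T κ u κ' u' α β).tsum_eq
  simp_rw [h1, h2]
  exact (hasSum_wilsonW₂_ff_u' T κ u κ' α β).tsum_eq

end Charge

/-! ## §3 The value at the colour-traced table `w22 N` on the pattern `(κ, κ; α, α)`, `κ ≠ α` -/

section Value

/-- [folklore] Every plaquette position points along one of the two plaquette directions. -/
theorem dir_eq_or (μ ν : Fin (d + 1)) (k : Fin 4) : dir μ ν k = μ ∨ dir μ ν k = ν := by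
  fin_cases k <;> simp [dir]

/-- [folklore] THE INNER FRAME SUM at `(μ, ν)`, for the pattern `(κ, κ; α, α)`: written out position by position. -/
theorem frame_eq (T : Fin 4 → Fin 4 → Fin 4 → Fin 4 → ℝ) (μ ν κ α : Fin (d + 1)) :
    (∑ k : Fin 4, ∑ l : Fin 4,
        if dir μ ν k = κ ∧ dir μ ν l = κ then
          ∑ i : Fin 4, ∑ j : Fin 4, (if α = dir μ ν i ∧ α = dir μ ν j then T i j k l else 0)
        else 0) =
      ∑ k : Fin 4, ∑ l : Fin 4, ∑ i : Fin 4, ∑ j : Fin 4,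
        if dir μ ν k = κ ∧ dir μ ν l = κ ∧ α = dir μ ν i ∧ α = dir μ ν j then T i j k l else 0 := by
  refine Finset.sum_congr rfl fun k _ => Finset.sum_congr rfl fun l _ => ?_
  split_ifs with h
  · refine Finset.sum_congr rfl fun i _ => Finset.sum_congr rfl fun j _ => ?_
    simp only [h, true_and]
  · symm
    refine Finset.sum_eq_zero fun i _ => Finset.sum_eq_zero fun j _ => ?_
    rw [if_neg]
    exact fun h' => h ⟨h'.1, h'.2.1⟩

/-- [folklore] A frame at `(μ, ν)` contributes NOTHING to the pattern `(κ, κ; α, α)` unless `κ` and `α` are both plaquette directions. -/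
theorem frame_eq_zero_of_not_mem (T : Fin 4 → Fin 4 → Fin 4 → Fin 4 → ℝ) {μ ν κ α : Fin (d + 1)}
    (h : ¬((κ = μ ∨ κ = ν) ∧ (α = μ ∨ α = ν))) :
    (∑ k : Fin 4, ∑ l : Fin 4,
        if dir μ ν k = κ ∧ dir μ ν l = κ then
          ∑ i : Fin 4, ∑ j : Fin 4, (if α = dir μ ν i ∧ α = dir μ ν j then T i j k l else 0)
        else 0) = 0 := by
  refine Finset.sum_eq_zero fun k _ => Finset.sum_eq_zero fun l _ => ?_
  split_ifs with hk
  · refine Finset.sum_eq_zero fun i _ => Finset.sum_eq_zero fun j _ => ?_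
    rw [if_neg]
    rintro ⟨hi, -⟩
    apply h
    refine ⟨?_, ?_⟩
    · rcases dir_eq_or μ ν k with h0 | h0
      · exact Or.inl (hk.1.symm.trans h0)
      · exact Or.inr (hk.1.symm.trans h0)
    · rcases dir_eq_or μ ν i with h0 | h0
      · exact Or.inl (hi.trans h0)
      · exact Or.inr (hi.trans h0)
  · rfl

/-- [folklore] FRAME SUM #1 — background positions `{0, 2}` (direction `μ = κ`), fluctuation positions `{1, 3}` (direction `ν = α`),
`κ ≠ α`: `Σ_{i,j ∈ {1,3}} Σ_{k,l ∈ {0,2}} w22 N i j k l = −N²`. -/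
theorem frame_w22_bg02_fl13 (N : ℕ) {κ α : Fin (d + 1)} (hκα : κ ≠ α) :
    (∑ k : Fin 4, ∑ l : Fin 4,
        if dir κ α k = κ ∧ dir κ α l = κ then
          ∑ i : Fin 4, ∑ j : Fin 4, (if α = dir κ α i ∧ α = dir κ α j then w22 N i j k l else 0)
        else 0) = -((N : ℝ) ^ 2) := by
  have hακ : α ≠ κ := fun h => hκα h.symm
  simp only [Fin.sum_univ_four, dir, Matrix.cons_val_zero, Matrix.cons_val_one, Matrix.head_cons, Matrix.cons_val_two,
    Matrix.tail_cons, Matrix.cons_val_three, hακ, and_true, and_false, if_true, if_false, add_zero, zero_add]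
  simp [w22, wSym, wPair, sgn, inc, qq]
  ring

/-- [folklore] FRAME SUM #2 — background positions `{1, 3}` (direction `ν = κ`), fluctuation positions `{0, 2}` (direction `μ = α`),
`κ ≠ α`: `Σ_{i,j ∈ {0,2}} Σ_{k,l ∈ {1,3}} w22 N i j k l = −N²`. -/
theorem frame_w22_bg13_fl02 (N : ℕ) {κ α : Fin (d + 1)} (hκα : κ ≠ α) :
    (∑ k : Fin 4, ∑ l : Fin 4,
        if dir α κ k = κ ∧ dir α κ l = κ then
          ∑ i : Fin 4, ∑ j : Fin 4, (if α = dir α κ i ∧ α = dir α κ j then w22 N i j k l else 0)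
        else 0) = -((N : ℝ) ^ 2) := by
  have hακ : α ≠ κ := fun h => hκα h.symm
  simp only [Fin.sum_univ_four, dir, Matrix.cons_val_zero, Matrix.cons_val_one, Matrix.head_cons, Matrix.cons_val_two,
    Matrix.tail_cons, Matrix.cons_val_three, hακ, and_true, and_false, if_true, if_false, add_zero, zero_add]
  simp [w22, wSym, wPair, sgn, inc, qq]
  ring

/-- [folklore] **THE QUARTIC WILSON CHARGE ON THE PATTERN `(κ, κ; α, α)`, `κ ≠ α`, IS `−2N²`**: at the colour-traced table `w22 N`
(`PlaquetteVertex2Trace`), for every first bond `(κ, u)` and every `d`,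
`∑' u′, ∑' x, ∑' z, wilsonW₂ d (w22 N) κ u κ u′ x z (inl α) (inl α) = −2·N²`
— the `(c·a)² − c²a²` structure of `tr [A_κ, A_α]²` on a constant background `c = e_κ` and a constant fluctuation `a = e_α`:
only the two plaquette frames `(μ, ν) = (κ, α)` and `(α, κ)` contribute, `−N²` each. -/
theorem tsum_wilsonW₂_w22_ff_diag_offdiag (N : ℕ) {κ α : Fin (d + 1)} (hκα : κ ≠ α) (u : Fin (d + 1) → ℤ) :
    ∑' u' : Fin (d + 1) → ℤ, ∑' x : Fin (d + 1) → ℤ, ∑' z : Fin (d + 1) → ℤ,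
        wilsonW₂ d (w22 N) κ u κ u' x z (Sum.inl α) (Sum.inl α) = -2 * (N : ℝ) ^ 2 := by
  rw [tsum_wilsonW₂_ff_eq]
  -- the double sum over plaquette orientations as ONE sum over pairs, then only `(κ, α)` and `(α, κ)` survive
  rw [← Fintype.sum_prod_type' (f := fun μ ν => ∑ k : Fin 4, ∑ l : Fin 4,
        if dir μ ν k = κ ∧ dir μ ν l = κ then
          ∑ i : Fin 4, ∑ j : Fin 4, (if α = dir μ ν i ∧ α = dir μ ν j then w22 N i j k l else 0)
        else 0)]
  rw [Finset.sum_eq_add (κ, α) (α, κ) (by simpa [Prod.ext_iff] using fun h _ => hκα h)]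
  · rw [frame_w22_bg02_fl13 N hκα, frame_w22_bg13_fl02 N hκα]; ring
  · rintro ⟨μ, ν⟩ - ⟨h1, h2⟩
    refine frame_eq_zero_of_not_mem (w22 N) ?_
    rintro ⟨hκ | hκ, hα | hα⟩
    · exact hκα (hκ.trans hα.symm)
    · exact h1 (Prod.ext hκ.symm hα.symm)
    · exact h2 (Prod.ext hα.symm hκ.symm)
    · exact hκα (hκ.trans hα.symm)
  · exact fun h => absurd (Finset.mem_univ _) h
  · exact fun h => absurd (Finset.mem_univ _) h

/-- [folklore] **THE QUARTIC WILSON TABLE HAS A NONZERO FOUR-CONSTANT-LEG CHARGE** (`N ≠ 0`, two distinct directions `κ ≠ α`, which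
exist as soon as `1 ≤ d`): the input that makes the exact pin `λ = 1` NECESSARY for ROW W3-F4d (`hZ0`) of the row owner's SKELETON-W3
(RULINGS-14d) — «(S4c)» is false, in contrast with the cubic table's (S3c)₀. -/
theorem tsum_wilsonW₂_w22_ff_ne_zero {N : ℕ} (hN : N ≠ 0) {κ α : Fin (d + 1)} (hκα : κ ≠ α) (u : Fin (d + 1) → ℤ) :
    ∑' u' : Fin (d + 1) → ℤ, ∑' x : Fin (d + 1) → ℤ, ∑' z : Fin (d + 1) → ℤ,
        wilsonW₂ d (w22 N) κ u κ u' x z (Sum.inl α) (Sum.inl α) ≠ 0 := by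
  rw [tsum_wilsonW₂_w22_ff_diag_offdiag N hκα u]
  have hN' : (N : ℝ) ≠ 0 := by exact_mod_cast hN
  exact mul_ne_zero (by norm_num) (pow_ne_zero 2 hN')

end Value

end Summit.QuantumFields.BalabanUV.Beta.GAN24.WilsonQuarticCharge

end
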